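import Mathlib

/-!
# Beta / ModeSum — mode sums over a biorthogonal (Parseval) system: mode-by-mode multiplication, the explicit group
# inverse, explicit kernel ∕ co-kernel, the defect formula and the diagonal-similarity identity (the CAP lane's (S1)–(S2))
# (β sub-cell, CAP lane «KERNEL ALGEBRA + EXPORT», lineage `b2b-balaban-beta-cap3`, gen 10; item R5′(i) of the gen-9 addendum memo
# `HOME/b2b-balaban-beta-cap3/g9/CAPSPLIT-cap3-g9-add1.md` §A.1, §A.4–A.6; companion leaf of `Beta/SaddleInverse.lean`, which it does
# NOT import and which does not import it)

In the un-gauge-fixed bond formulation of the cell's one-loop fibre problem the (centre-alias deflated) Wilson block Hessian at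
complex coarse momentum is a MODE SUM `A = Σ_t E_t N_t F_t` over the 3⁴ fine aliases `t`, where `F_t E_s = δ_ts · 1` is fine-lattice
Parseval on the block (normalised) and `N_t` is an explicit 4 × 4 matrix; the similarity `E_t ↦ M⁻¹ E_t`, `F_t ↦ F_t M` by the
diagonal matrix `M = diag(e^{−y·x})` is how the imaginary part of the momentum enters (addendum §A.1, (S1)).  Consequences, all
one-liners once biorthogonality is a hypothesis (§A.4–A.5, (S2)): the sums multiply MODE BY MODE, so mode-wise commuting
{1,2}-inverses `N_t^#` give the GROUP INVERSE `A^# = Σ_t E_t N_t^# F_t` of `A`; a kernel vector of `N_s` planted at mode `s` is a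
kernel vector of `A` (longitudinal and centre-alias modes); with completeness `Σ_t E_t F_t = 1` the defect is
`1 − A A^# = Σ_t E_t (1 − N_t N_t^#) F_t` — the hypothesis `A G = 1 − Y L` under which `Beta/SaddleInverse.lean` inverts the bordered
matrix explicitly.  The numerical observations behind this (jobs J11–J13 = j084816, j084883, j084968; group-inverse residuals ≤ 1e-13)
are FLOATS and orientation only; nothing below depends on them.

Everything is stated for matrices over an arbitrary commutative ring `R` with arbitrary finite index types (mode index `ι`, mode
size `a`, ambient size `n`), so it applies verbatim to the engines' exact-rational objects and to `ℂ`.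

HONEST FRAMING.  Kernel algebra only, [folklore] throughout (finite sums of matrix products; «group inverse» appears only as the
three defining identities about explicit products — no `Matrix.pinv` theory is used or asserted).  This module proves NO bound, NO
number of the β-function, NO statement about Bałaban's operators and NO instance for the cell's concrete 324-bond matrices or its
81 aliases (the biorthogonality of the concrete alias system is a finite roots-of-unity identity left to the instance); it
discharges NOTHING of `FlowStep.BetaPertH`.  Discharging `BetaPertH` would make Bałaban's ultraviolet stability unconditional —
NOT the continuum limit and NOT the Clay problem.  0 `sorry`, 0 cite tags, imports Mathlib only.
-/

namespace Summit.QuantumFields.BalabanUV.Beta.ModeSum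

open Matrix

variable {R : Type*} [CommRing R]

/-! ## Mode sums over a biorthogonal system: Parseval group inverse, kernel, defect, similarity (S1)–(S2) -/

section ModeSum

variable {ι a b n : Type*} [Fintype ι] [Fintype a]

/-- `Σ_t E_t X_t F_t`. [folklore] -/
def modeSum (E : ι → Matrix n a R) (F : ι → Matrix a n R) (X : ι → Matrix a a R) : Matrix n n R :=
  ∑ t, E t * X t * F t

variable [Fintype n]

/-- SIMILARITY (S1): conjugating the system (`E_t ↦ M⁻¹ E_t`, `F_t ↦ F_t M`) conjugates every mode sum — the complex coarse
momentum enters the variable block only through the mode matrices and a diagonal similarity. [folklore] -/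
theorem modeSum_similar (M Mi : Matrix n n R) (E : ι → Matrix n a R) (F : ι → Matrix a n R) (X : ι → Matrix a a R) :
    modeSum (fun t => Mi * E t) (fun t => F t * M) X = Mi * modeSum E F X * M := by
  unfold modeSum
  rw [Matrix.mul_sum, Matrix.sum_mul]
  refine Finset.sum_congr rfl fun t _ => ?_
  simp only [← Matrix.mul_assoc]

variable [DecidableEq ι] [DecidableEq a]

/-- Biorthogonality `F_t E_s = δ_ts · 1` (the normalised fine-Parseval relation `𝒫_t 𝒫♭_sᵀ = 81 δ_ts 1₄` of the addendum,
with the constant absorbed into `F`). [folklore] -/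
def Biorth (E : ι → Matrix n a R) (F : ι → Matrix a n R) : Prop :=
  ∀ t s, F t * E s = if t = s then 1 else 0

variable {E : ι → Matrix n a R} {F : ι → Matrix a n R}

omit [Fintype ι] [Fintype a] in
/-- … preserved by a similarity with `M Mi = 1`. [folklore] -/
theorem Biorth.similar [DecidableEq n] (h : Biorth E F) {M Mi : Matrix n n R} (hM : M * Mi = 1) :
    Biorth (fun t => Mi * E t) (fun t => F t * M) := by
  intro t s
  show F t * M * (Mi * E s) = _
  rw [Matrix.mul_assoc, ← Matrix.mul_assoc M, hM, Matrix.one_mul, h t s]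

/-- [folklore] -/
theorem Biorth.F_mul_modeSum (h : Biorth E F) (X : ι → Matrix a a R) (s : ι) :
    F s * modeSum E F X = X s * F s := by
  unfold modeSum
  rw [Matrix.mul_sum]
  have e : ∀ t, F s * (E t * X t * F t) = if s = t then X s * F s else 0 := by
    intro t
    rw [← Matrix.mul_assoc, ← Matrix.mul_assoc, h s t]
    split_ifs with hst
    · subst hst; rw [Matrix.one_mul]
    · rw [Matrix.zero_mul, Matrix.zero_mul]
  simp_rw [e]
  rw [Finset.sum_ite_eq, if_pos (Finset.mem_univ _)]

/-- [folklore] -/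
theorem Biorth.modeSum_mul_E (h : Biorth E F) (X : ι → Matrix a a R) (s : ι) :
    modeSum E F X * E s = E s * X s := by
  unfold modeSum
  rw [Matrix.sum_mul]
  have e : ∀ t, E t * X t * F t * E s = if t = s then E s * X s else 0 := by
    intro t
    rw [Matrix.mul_assoc, h t s]
    split_ifs with hts
    · subst hts; rw [Matrix.mul_one]
    · rw [Matrix.mul_zero]
  simp_rw [e]
  rw [Finset.sum_ite_eq', if_pos (Finset.mem_univ _)]

/-- MODE-BY-MODE MULTIPLICATION: `(Σ E X F)(Σ E Y F) = Σ E (X Y) F`. [folklore] -/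
theorem Biorth.modeSum_mul_modeSum (h : Biorth E F) (X Y : ι → Matrix a a R) :
    modeSum E F X * modeSum E F Y = modeSum E F (fun t => X t * Y t) := by
  show (∑ t, E t * X t * F t) * modeSum E F Y = ∑ t, E t * (X t * Y t) * F t
  rw [Matrix.sum_mul]
  refine Finset.sum_congr rfl fun t _ => ?_
  rw [Matrix.mul_assoc, h.F_mul_modeSum, ← Matrix.mul_assoc, Matrix.mul_assoc (E t)]

/-- GROUP INVERSE (S2): if each `Y_t` is a commuting {1,2}-inverse of `X_t` then `Σ E Y F` is one of `Σ E X F`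
(the explicit fine-Parseval group inverse `A^# = (1/81) Σ_t 𝒫♭_tᵀ (Π_t/Δ_t) 𝒫_t` of the addendum). [folklore] -/
theorem Biorth.groupInverse (h : Biorth E F) {X Y : ι → Matrix a a R} (h1 : ∀ t, X t * Y t * X t = X t)
    (h2 : ∀ t, Y t * X t * Y t = Y t) (h3 : ∀ t, X t * Y t = Y t * X t) :
    modeSum E F X * modeSum E F Y * modeSum E F X = modeSum E F X ∧
      modeSum E F Y * modeSum E F X * modeSum E F Y = modeSum E F Y ∧
      modeSum E F X * modeSum E F Y = modeSum E F Y * modeSum E F X := by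
  refine ⟨?_, ?_, ?_⟩
  · rw [h.modeSum_mul_modeSum, h.modeSum_mul_modeSum]
    exact congrArg (modeSum E F) (funext fun t => show X t * Y t * X t = X t from h1 t)
  · rw [h.modeSum_mul_modeSum, h.modeSum_mul_modeSum]
    exact congrArg (modeSum E F) (funext fun t => show Y t * X t * Y t = Y t from h2 t)
  · rw [h.modeSum_mul_modeSum, h.modeSum_mul_modeSum]
    exact congrArg (modeSum E F) (funext fun t => show X t * Y t = Y t * X t from h3 t)

/-- EXPLICIT KERNEL: a kernel vector of the mode matrix `X_s`, planted at mode `s`, is killed by the mode sum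
(longitudinal modes `𝒫♭_tᵀ d_t`, centre-alias modes `𝒫♭_0ᵀ e_μ`). [folklore] -/
theorem Biorth.modeSum_mul_eq_zero (h : Biorth E F) {X : ι → Matrix a a R} {s : ι} {D : Matrix a b R}
    (hD : X s * D = 0) : modeSum E F X * (E s * D) = 0 := by
  rw [← Matrix.mul_assoc, h.modeSum_mul_E, Matrix.mul_assoc, hD, Matrix.mul_zero]

/-- EXPLICIT CO-KERNEL, likewise on the left. [folklore] -/
theorem Biorth.mul_modeSum_eq_zero (h : Biorth E F) {X : ι → Matrix a a R} {s : ι} {D : Matrix b a R}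
    (hD : D * X s = 0) : D * F s * modeSum E F X = 0 := by
  rw [Matrix.mul_assoc, h.F_mul_modeSum, ← Matrix.mul_assoc, hD, Matrix.zero_mul]

/-- DEFECT FORMULA: with completeness `Σ_t E_t F_t = 1`, `1 − (Σ E X F)(Σ E Y F) = Σ_t E_t (1 − X_t Y_t) F_t` — the kernel
projector through which the defect of `A^#` factors (hypothesis `A G = 1 − Y L` of §1). [folklore] -/
theorem Biorth.one_sub_modeSum_mul [DecidableEq n] (h : Biorth E F) (hc : ∑ t, E t * F t = 1)
    (X Y : ι → Matrix a a R) : 1 - modeSum E F X * modeSum E F Y = modeSum E F (fun t => 1 - X t * Y t) := by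
  rw [h.modeSum_mul_modeSum, ← hc]
  unfold modeSum
  rw [← Finset.sum_sub_distrib]
  refine Finset.sum_congr rfl fun t _ => ?_
  simp only [Matrix.mul_sub, Matrix.sub_mul, Matrix.mul_one]

end ModeSum

end Summit.QuantumFields.BalabanUV.Beta.ModeSum
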